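import Summits.BirchSwinnertonDyer.BirchSwinnertonDyer.Theorems.ByReductionTypeAtTwoMultTransportTwistedDescentDualControl
import HarnessLib

/-!
# Route UniversalToricDescent — Greenberg's twisted descent, dual side: reading a dual Selmer class of
# `H¹(Γ_K, E[p^J](χ_u)^D)` in `E[p^J](χ_{u'})` through the twisted Weil duality — local triviality and unramifiedness
# transfer to `y'`, STRUCTURE-INDEPENDENTLY

Lead prover bsd-wall-utd-p1 g14 (`--supports` ♭T′ stmt-BirchSwinnertonDyer-26975; line `sigmacongruence` v3, twist bricks for the twin stubs
TS1/TS2). t42's `MultTransportTwistedDescent.res_eq_zero_of_mem_dualSelmer` / `res_mem_unramifiedSubgroup_of_mem_dualSelmer`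
(file `…TwistedDescentDualControl`, K = any number field) prove, for THEIR Kummer structure, that a dual class `y = H¹(w) y'` which
is locally trivial (resp. dual-unramified) at `v` has `res_v y' = 0` (resp. `res_v y'` unramified). The arguments use the structure
only to produce those local facts. This file states the two transports with the local facts as HYPOTHESES, so that every Selmer
structure can use them — in particular the strict structure `𝓕_Q` of `…TwistedStrictLift` (local facts:
`localization_eq_zero_of_mem_dualSelmer_strict`, `localization_mem_dual_unramified_of_mem_dualSelmer_strict`):

* §1 `res_eq_zero_of_localization_map_eq_zero` — `loc_v (H¹(w) y') = 0 ⟹ res_v y' = 0` (`H¹(w|_{K_v})` is injective: `w⁻¹`);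
* §2 `res_mem_unramifiedSubgroup_of_localization_map_mem` — `loc_v (H¹(w) y') ∈ H¹_ur(M_J^D) ⟹ res_v y' ∈ H¹_ur(M_J(χ_{u'}))`.

Proofs VERBATIM t42's with the first line re-sourced. HONEST STATUS: helper theorems (plumbing). THEOREMS ONLY; no definition, no
named fact, no `sorry`. BSD is not advanced by this file.
References: [GreenbergLNM1716] §4 pp. 123–124; [MilneADT2006] Ch. I, Thm. 2.6, §6; [SilvermanAEC2009] III.8.1.
-/

set_option autoImplicit false
-- `…BirchSwinnertonDyer.BirchSwinnertonDyer.Theorems…` is the problem's mandated namespace (D-0017).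
set_option linter.dupNamespace false

noncomputable section
open scoped Classical

namespace Summit.BirchSwinnertonDyer.BirchSwinnertonDyer.Theorems.UniversalToricDescentTwistedDescent

open NumberField IsDedekindDomain Field WeierstrassCurve CategoryTheory
  Literature.NumberTheory.EllipticCurves Literature.NumberTheory.GaloisRepresentations Literature.NumberTheory.GaloisCohomology
open Literature.NumberTheory.GaloisRepresentations.DiscreteGaloisModule (unramifiedSubgroup TateDual)

variable {K : Type} [Field K] [NumberField K] (W : WeierstrassCurve K) [W.IsElliptic] (p : ℕ) [Fact p.Prime]
  (κ : ZpExtension K p) (J : ℕ) {u u' : ℤ}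
  (hu : (p : ℤ) ∣ u - 1) (hu' : (p : ℤ) ∣ u' - 1) (huu' : ((p : ℤ) ^ J) ∣ u * u' - 1)
  (e : W.geomTorsion ((p ^ J : ℕ) : ℤ) → W.geomTorsion ((p ^ J : ℕ) : ℤ) → AlgebraicClosure K)
  (hμ : ∀ S T, e S T ^ (p ^ J) = 1)
  (hadd₁ : ∀ S₁ S₂ T, e (S₁ + S₂) T = e S₁ T * e S₂ T)
  (hadd₂ : ∀ S T₁ T₂, e S (T₁ + T₂) = e S T₁ * e S T₂)
  (hgal : ∀ (σ : absoluteGaloisGroup K) (S T : W.geomTorsion ((p ^ J : ℕ) : ℤ)),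
    σ • e S T = e (σ • S) (σ • T))
  (hnondeg : ∀ T, (∀ S, e S T = 1) → T = 0)
  [Finite (W.geomTorsion ((p ^ J : ℕ) : ℤ))] [CharZero K]

include hnondeg

/-! ### §1 Local triviality transfers through the twisted Weil duality -/

-- adapted from `MultTransportTwistedDescent.res_eq_zero_of_mem_dualSelmer` (t42, …TwistedDescentDualControl): first line a hypothesis
/-- **`loc_v (H¹(w) y') = 0 ⟹ res_v y' = 0`** at a finite place `v` (`H¹(w|_{K_v})` is injective since `w⁻¹` is a pointwise
inverse). [cite: GreenbergLNM1716, §4 p. 123] [cite: SilvermanAEC2009, Prop. III.8.1] -/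
theorem res_eq_zero_of_localization_map_eq_zero (y' : galoisCohomology (W.twistedTorsionGaloisModule p κ J u' hu') 1)
    {v : HeightOneSpectrum (𝓞 K)}
    (h0 : galoisCohomology.localization ((W.twistedTorsionGaloisModule p κ J u hu).tateDual (p ^ J)) (Sum.inr v) 1
      (galoisCohomology.map (W.twistedWeilDual p κ J hu hu' huu' e hμ hadd₁ hadd₂ hgal) 1 y') = 0) :
    galoisCohomology.res (W.twistedTorsionGaloisModule p κ J u' hu') (v.adicCompletion K) 1 y' = 0 := by
  have h1 : galoisCohomology.map
      ((W.twistedWeilDual p κ J hu hu' huu' e hμ hadd₁ hadd₂ hgal).restrictField (v.adicCompletion K)) 1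
      (galoisCohomology.res (W.twistedTorsionGaloisModule p κ J u' hu') (v.adicCompletion K) 1 y') = 0 := by
    rw [← W.res_map_twistedWeilDual p κ J hu hu' huu' e hμ hadd₁ hadd₂ hgal (v.adicCompletion K) y']
    exact h0
  refine map_injective_of_leftInverse
    ((W.twistedWeilDual p κ J hu hu' huu' e hμ hadd₁ hadd₂ hgal).restrictField (v.adicCompletion K))
    ((W.twistedWeilDualInv p κ J hu hu' huu' e hμ hadd₁ hadd₂ hgal hnondeg).restrictField (v.adicCompletion K))
    (fun m ↦ W.twistedWeilDualInv_apply p κ J hu hu' huu' e hμ hadd₁ hadd₂ hgal hnondeg m) ?_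
  rw [h1, map_zero]

/-! ### §2 Unramifiedness transfers through the twisted Weil duality -/

-- adapted from `MultTransportTwistedDescent.res_mem_unramifiedSubgroup_of_mem_dualSelmer` (t42): first lines a hypothesis
/-- **`loc_v (H¹(w) y') ∈ H¹_ur(M_J^D) ⟹ res_v y' ∈ H¹_ur(E[p^J](χ_{u'}))`** at a finite place `v` (unramifiedness is the
vanishing of the restriction to `K_v^{ur}`, which commutes with `H¹(w)`, injective over `K_v^{ur}` as well).
[cite: MilneADT2006, Ch. I, Thm. 2.6] [cite: GreenbergLNM1716, §4 p. 124] -/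
theorem res_mem_unramifiedSubgroup_of_localization_map_mem
    (y' : galoisCohomology (W.twistedTorsionGaloisModule p κ J u' hu') 1) {v : HeightOneSpectrum (𝓞 K)}
    (hyv : galoisCohomology.localization ((W.twistedTorsionGaloisModule p κ J u hu).tateDual (p ^ J)) (Sum.inr v) 1
        (galoisCohomology.map (W.twistedWeilDual p κ J hu hu' huu' e hμ hadd₁ hadd₂ hgal) 1 y') ∈
      unramifiedSubgroup (GaloisRep.toLocal v ((W.twistedTorsionGaloisModule p κ J u hu).tateDual (p ^ J))) 1) :
    galoisCohomology.res (W.twistedTorsionGaloisModule p κ J u' hu') (v.adicCompletion K) 1 y' ∈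
      unramifiedSubgroup ((W.twistedTorsionGaloisModule p κ J u' hu').restrictField (v.adicCompletion K)) 1 := by
  set wJ := W.twistedWeilDual p κ J hu hu' huu' e hμ hadd₁ hadd₂ hgal with hwJ
  set wI := W.twistedWeilDualInv p κ J hu hu' huu' e hμ hadd₁ hadd₂ hgal hnondeg with hwI
  -- `hyv : loc_v (H¹(w) y') ∈ H¹_ur(M_J^D)`, i.e. its restriction to `K_v^{ur}` vanishes
  replace hyv := (DiscreteGaloisModule.mem_unramifiedSubgroup_iff _ _ _).mp hyv
  refine (DiscreteGaloisModule.mem_unramifiedSubgroup_iff _ _ _).mpr ?_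
  have h1 : galoisCohomology.localization ((W.twistedTorsionGaloisModule p κ J u hu).tateDual (p ^ J))
      (Sum.inr v) 1 (galoisCohomology.map wJ 1 y') =
      galoisCohomology.map (wJ.restrictField (v.adicCompletion K)) 1
        (galoisCohomology.res (W.twistedTorsionGaloisModule p κ J u' hu') (v.adicCompletion K) 1 y') :=
    W.res_map_twistedWeilDual p κ J hu hu' huu' e hμ hadd₁ hadd₂ hgal (v.adicCompletion K) y'
  have h2 := galoisCohomology.res_map_one
    (IsNonarchimedeanLocalField.maxUnramified (v.adicCompletion K)) (wJ.restrictField (v.adicCompletion K))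
    (galoisCohomology.res (W.twistedTorsionGaloisModule p κ J u' hu') (v.adicCompletion K) 1 y')
  have h3 : galoisCohomology.map
      ((wJ.restrictField (v.adicCompletion K)).restrictField
        (IsNonarchimedeanLocalField.maxUnramified (v.adicCompletion K))) 1
      (galoisCohomology.res ((W.twistedTorsionGaloisModule p κ J u' hu').restrictField (v.adicCompletion K))
        (IsNonarchimedeanLocalField.maxUnramified (v.adicCompletion K)) 1
        (galoisCohomology.res (W.twistedTorsionGaloisModule p κ J u' hu') (v.adicCompletion K) 1 y')) = 0 := by
    rw [← h2]
    have h1' := congrArg (galoisCohomology.res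
      (((W.twistedTorsionGaloisModule p κ J u hu).tateDual (p ^ J)).restrictField (v.adicCompletion K))
      (IsNonarchimedeanLocalField.maxUnramified (v.adicCompletion K)) 1) h1
    rw [← h1']
    exact hyv
  refine map_injective_of_leftInverse
    ((wJ.restrictField (v.adicCompletion K)).restrictField
      (IsNonarchimedeanLocalField.maxUnramified (v.adicCompletion K)))
    ((wI.restrictField (v.adicCompletion K)).restrictField
      (IsNonarchimedeanLocalField.maxUnramified (v.adicCompletion K)))
    (fun m ↦ W.twistedWeilDualInv_apply p κ J hu hu' huu' e hμ hadd₁ hadd₂ hgal hnondeg m) ?_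
  rw [h3, map_zero]

end Summit.BirchSwinnertonDyer.BirchSwinnertonDyer.Theorems.UniversalToricDescentTwistedDescent

end
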